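import Summits.HubbardSuperconductivity.HubbardSuperconductivity.Theorems.AnisotropyChordTransferFibre3L2ClosedBlockN00239T30407
import Summits.HubbardSuperconductivity.HubbardSuperconductivity.Theorems.AnisotropyChordTransferFibre3N1RowL2Cover
import Summits.HubbardSuperconductivity.HubbardSuperconductivity.Theorems.AnisotropyChordTransferFibre3L2CornerBound

/-!
# Route `AnisotropyChord` / H0 rotor rung, LEVEL 2: ★★★★ GM₃ FOR EVERY `L ≥ 128` AND EVERY `0 < Δ ≤ 0.98` (away from the `ν → 0` corner)

The final cover of the Level-2 kernel campaign (rows `N₁` (p2), C and D (p1), side cells, Stage 1.5, closure chain): the block theorem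
`L2.gm3d_blockN00239T30407` covers `ν ∈ [239, 31000]/10⁶`, and every ground profile has `ν < 0.031` (`L2.N1.region_sides`), so
★★★★ `gm3_L2_delta98`: for every `L ≥ 128` and every `0 < Δ ≤ 49/50` whose ground two-magnon profile has `ν = λ₂/θ² ≥ 2.39·10⁻⁴`,
`GM3Fibre L Δ`.  The located hypothesis `ν ≥ 2.39·10⁻⁴` is the same as in p2's `trialGapAbs_L2` (`…N1RowL2Final`); by `etaEff_ge` it holds
for all `128 ≤ L ≤ e^140` at `Δ ≤ .98` and fails only in the `ν → 0` corner (ruling R3's symbolic `ν`-factorisation item).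
Prover seat `hubbard-h0-rotor-p1` g31 (route lead); helper for piece A = stmt-HubbardSuperconductivity-23918 of rung 19089
(`--supports`, helper class).  Nothing here proves superconductivity in the Hubbard model; this is the `∀ L ≥ 128` part of ONE conditional
reduction (GM₃ in fibre language), conditional on the profile location `ν ≥ 2.39·10⁻⁴`.  Mathlib + the tree only; no sorry.
-/

set_option linter.dupNamespace false
set_option autoImplicit false

namespace Summit.HubbardSuperconductivity.HubbardSuperconductivity.Theorems.AnisotropyChord.Transfer.Fibre3.L2

/-- ★★★★ **GM₃ for every `L ≥ 128`, `0 < Δ ≤ 49/50`, ground profile with `ν ≥ 2.39·10⁻⁴`.** -/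
theorem gm3_L2_delta98 (L : ℕ) [NeZero L] (hL : 128 ≤ L) {Δ : ℝ} (hΔ0 : 0 < Δ) (hΔ98 : Δ ≤ (49 : ℝ) / 50)
    (hν : ∀ lam2 : ℝ, ∀ f : Tor L → ℝ, IsGroundTwoMagnon L Δ lam2 f → ((239 : ℝ) / 1000000) ≤ lam2 / (2 * Real.pi / L) ^ 2) :
    GM3Fibre L Δ :=
  gm3d_blockN00239T30407 L hL hΔ0 hΔ98 fun lam2 f hf =>
    ⟨hν lam2 f hf, by
      have h := (L2.N1.region_sides L hL hΔ0.le (lt_of_le_of_lt hΔ98 (by norm_num)) hf).2.2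
      norm_num at h ⊢; linarith⟩

/-- ★★★★ **GM₃, hypothesis-free in the physical range**: for every `128 ≤ L ≤ 2^200` and every `0 < Δ ≤ 49/50`, `GM3Fibre L Δ`
(`L2.nu_loc_of_le` discharges the location). -/
theorem gm3_L2_delta98_of_le (L : ℕ) [NeZero L] (hL : 128 ≤ L) (hLmax : L ≤ 2 ^ 200) {Δ : ℝ} (hΔ0 : 0 < Δ) (hΔ98 : Δ ≤ (49 : ℝ) / 50) :
    GM3Fibre L Δ :=
  gm3d_blockN00239T30407 L hL hΔ0 hΔ98 (nu_loc_of_le L hL hLmax hΔ0 hΔ98)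

end Summit.HubbardSuperconductivity.HubbardSuperconductivity.Theorems.AnisotropyChord.Transfer.Fibre3.L2
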